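import Summits.NavierStokesRegularity.FluidComputer.HeadStartPulseBeable

/-!
# The head-start gate under a POLYNOMIAL amplitude threshold, part 4: the theorem

Cell `pub-fluidc`, blueprint seat bp1, gen 20 (parts 1–3: `HeadStartPulse{Fire,Douse,Beable}.lean`).
HONEST FRAMING (verbatim): low prior, high value-of-information experiment on Tao's machine paradigm; NOT a
claim that NS blows up. A theorem about the five-mode ODE (5.5) of [Tao2016AveragedNS, §5.5] in the retuned
form `delayCircuitWith K M ε`, under a diagonal damping `-E(t) * X(t)`, `0 ≤ Eᵢ(t) ≤ η ≤ 1/1000`, on `[0,2]`,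
from the signed head-start class `HS±(ε)` (`a₀² + b₀² = 1`, `a₀ ≥ 0`, `-ε/5 ≤ b₀ ≤ 2ε/5`, `c₀ = d₀ = ã₀ = 0`);
nothing is proved about Navier–Stokes.

`HeadStart.firingPhase_poly` is `HeadStart.firingPhase` (tree, `HeadStartBeable.lean`) VERBATIM — same
family `K ≥ 2·20⁴²·42! + 16`, `3000 log K ≤ M ≤ K¹⁰`, same damping class, same datum class, same critical-time
window, same (able) and (beable) with the same constants on the same intervals — with the single change
  `ε ≤ e^{-10M}/K¹⁰⁰`  ↦  `ε ≤ e^{-900·M·log K/K}/K²³⁰⁰`,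
a threshold POLYNOMIAL in `K` whenever `M·log K ≲ K` (`firingPhase_polyLinear`: `900·M·log K ≤ K` ⇒
`ε ≤ K⁻²³⁰¹` suffices), e.g. `ε ≤ K⁻²³⁰¹` on the whole slow band `3000 log K ≤ M ≤ K/(900 log K)`. The
mechanism is the PULSE ARGUMENT of parts 1–3: (fire)/(douse)/(toke) are run only up to the delivery time
`T₀ = t_c + 888 log K/M + 1/K + 300 log K/K` under the pulse hypothesis `64·M·ε²·e^{5M(T₀ - t_c)} ≤ K²⁰`
(`pulse_eps_facts`), the delivered bound `a² + b² + c² + d² ≤ 142K⁻²⁰` then persists on `[T₀, 2]` because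
that quantity never increases (`sumFour_antitoneOn`), and `beable_of_sum_sq` (tree) converts it into
(beable); `firingPhase_poly_early` records the earlier onset `T₀ ≤ t_c + 888 log K/M + 1/√K`. REMARK (not
formalised): some smallness of `ε` beyond `K⁻¹⁰⁰` is needed for (beable) as printed only through the rotor
`b ⇒ c` staying frozen until delivery; after delivery no hypothesis on the clock is used at all.
[cite: Tao2016AveragedNS, Theorem 5.3, §5.5]. No named facts; 0 sorry.
-/

noncomputable section

namespace Summit.NavierStokesRegularity.FluidComputer

open Real Set Filter Topology
open Literature.Analysis.FluidPDE.Tao2016AveragedNS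
open Literature.Analysis.FluidPDE.Tao2016AveragedNS.Thm53 (invSqrt_facts)
open Literature.Analysis.FluidPDE.Tao2016AveragedNS.Thm53With (family_params log_facts)
open DampedTransition (family_params_damped)

namespace HeadStart

section Numerics

/-! ## Numerics of the polynomial threshold (duplicated from the undamped `AmplitudeKnob` chain so that the
two chains are independent files) -/

/-- `e^{-M} ≤ K⁻¹⁰` once `M ≥ 10 log K`. [folklore] -/
theorem exp_neg_le_inv_pow {K M : ℝ} (hK0 : 0 < K) (hM : 10 * Real.log K ≤ M) :
    exp (-M) ≤ 1 / K ^ 10 := by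
  rw [one_div, ← Real.exp_log (pow_pos hK0 10), ← Real.exp_neg, Real.exp_le_exp, Real.log_pow]
  push_cast
  linarith

/-- (N4') for the drain time `L = 300 log K/K`: `2e^{-(K/10)L} = 2K⁻³⁰ ≤ K⁻²⁰`. [folklore] -/
theorem drain_numeric {K : ℝ} (hK : 16 ≤ K) :
    2 * exp (-(K / 10 * (300 * Real.log K / K))) ≤ 1 / K ^ 20 := by
  have hK0 : 0 < K := by linarith
  have hKne : K ≠ 0 := hK0.ne'
  have h : K / 10 * (300 * Real.log K / K) = (30 : ℕ) * Real.log K := by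
    push_cast; field_simp; ring
  rw [h, Real.exp_neg, Real.exp_nat_mul, Real.exp_log hK0, ← one_div, mul_one_div,
    div_le_div_iff₀ (by positivity) (by positivity), one_mul]
  have h10 : (2 : ℝ) ≤ K ^ 10 := by
    have : (16 : ℝ) ^ 10 ≤ K ^ 10 := pow_le_pow_left₀ (by norm_num) hK 10
    norm_num at this
    linarith
  calc 2 * K ^ 20 ≤ K ^ 10 * K ^ 20 := mul_le_mul_of_nonneg_right h10 (by positivity)
    _ = K ^ 30 := by ring

/-- `K ≥ K₀ = 2·20⁴²·42! + 16` is far above `1199⁴ ≈ 2.07·10¹²`. [folklore] -/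
theorem K0_ge {K : ℝ} (hK : 2 * 20 ^ 42 * (Nat.factorial 42 : ℝ) + 16 ≤ K) : (1199 : ℝ) ^ 4 ≤ K := by
  have hfac : (1 : ℝ) ≤ (Nat.factorial 42 : ℝ) := by
    exact_mod_cast Nat.succ_le_of_lt (Nat.factorial_pos 42)
  have h1 : (1199 : ℝ) ^ 4 ≤ 2 * 20 ^ 42 * 1 := by norm_num
  have h2 : (2 : ℝ) * 20 ^ 42 * 1 ≤ 2 * 20 ^ 42 * (Nat.factorial 42 : ℝ) :=
    mul_le_mul_of_nonneg_left hfac (by positivity)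
  linarith

/-- `1/K + 300 log K/K ≤ 1/√K` once `K ≥ 1199⁴` (`q = K^{1/4}`: `log K ≤ 4(q - 1)`, `1 + 1200(q - 1) ≤ q²`).
[folklore] -/
theorem inv_add_log_le_invSqrt {K : ℝ} (hK : (1199 : ℝ) ^ 4 ≤ K) :
    K⁻¹ + 300 * Real.log K / K ≤ (sqrt K)⁻¹ := by
  have hK0 : 0 < K := lt_of_lt_of_le (by norm_num) hK
  have hK16 : 16 ≤ K := le_trans (by norm_num) hK
  obtain ⟨-, -, hKs, -, -⟩ := invSqrt_facts hK16
  set q : ℝ := sqrt (sqrt K) with hq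
  have hsq : sqrt K = q ^ 2 := by rw [hq, sq_sqrt (sqrt_nonneg K)]
  have hK4 : K = q ^ 4 := by
    calc K = (sqrt K) ^ 2 := (sq_sqrt hK0.le).symm
      _ = q ^ 4 := by rw [hsq]; ring
  have hq1199 : 1199 ≤ q := by
    have h1 : sqrt ((1199 : ℝ) ^ 4) ≤ sqrt K := sqrt_le_sqrt hK
    have h2 : sqrt ((1199 : ℝ) ^ 4) = 1199 ^ 2 := by
      rw [show ((1199 : ℝ)) ^ 4 = (1199 ^ 2) ^ 2 by norm_num, sqrt_sq (by norm_num)]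
    rw [h2] at h1
    have h3 : sqrt ((1199 : ℝ) ^ 2) ≤ sqrt (sqrt K) := sqrt_le_sqrt h1
    rw [sqrt_sq (by norm_num)] at h3
    exact h3
  have hqpos : 0 < q := by linarith
  have hlog : Real.log K ≤ 4 * (q - 1) := by
    rw [hK4, Real.log_pow]
    push_cast
    have := Real.log_le_sub_one_of_pos hqpos
    linarith
  have key : 1 + 300 * Real.log K ≤ sqrt K := by
    calc 1 + 300 * Real.log K ≤ 1 + 1200 * (q - 1) := by linarith
      _ ≤ q ^ 2 := by
          nlinarith [mul_nonneg (sub_nonneg.2 (by linarith : (1 : ℝ) ≤ q)) (sub_nonneg.2 hq1199)]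
      _ = sqrt K := hsq.symm
  have hsum : K⁻¹ + 300 * Real.log K / K = (1 + 300 * Real.log K) / K := by
    field_simp
  have hKs' : (sqrt K)⁻¹ * K = sqrt K := by rw [mul_comm]; exact hKs
  rw [hsum, div_le_iff₀ hK0, hKs']
  exact key

/-- The smallness `ε ≤ e^{-900·M·log K/K}/K²³⁰⁰` in the forms used: `ε ≤ 1`, `ε² ≤ 1/(12K²⁰)`, `ε ≤ K⁻¹⁰⁰`,
and the PULSE HYPOTHESIS at the delivery time `T₀ - t_c = 888 log K/M + 1/K + 300 log K/K`:
`64·M·ε²·e^{5M(T₀ - t_c)} = 64·M·ε²·K⁴⁴⁴⁰·e^{5M/K}·K^{1500M/K} ≤ 64·M·K⁻¹⁶⁰·e^{(5 - 300 log K)M/K} ≤ K²⁰`.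
[folklore] -/
theorem pulse_eps_facts {K M ε : ℝ} (hK : 16 ≤ K) (hM0 : 0 < M) (hMK : M ≤ K ^ 10) (hε : 0 < ε)
    (hεle : ε ≤ exp (-(900 * M * Real.log K / K)) / K ^ 2300) :
    ε ≤ 1 ∧ ε ^ 2 ≤ 1 / (12 * K ^ 20) ∧ ε ≤ 1 / K ^ 100 ∧
      64 * M * ε ^ 2 * exp (5 * M * (888 * Real.log K / M + K⁻¹ + 300 * Real.log K / K))
        ≤ K ^ 20 := by
  have hK0 : 0 < K := by linarith
  have hK1 : 1 ≤ K := by linarith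
  have hKne : K ≠ 0 := hK0.ne'
  have hMne : M ≠ 0 := hM0.ne'
  obtain ⟨hlog2, -, hlog0⟩ := log_facts hK
  have hexp1 : exp (-(900 * M * Real.log K / K)) ≤ 1 := by
    rw [exp_le_one_iff, neg_nonpos]; positivity
  have h2300 : ε ≤ 1 / K ^ 2300 := hεle.trans (div_le_div_of_nonneg_right hexp1 (by positivity))
  have h100 : ε ≤ 1 / K ^ 100 := h2300.trans (by
    apply div_le_div_of_nonneg_left (by norm_num) (by positivity)
    exact pow_le_pow_right₀ hK1 (by norm_num))
  have hK100 : (1 : ℝ) ≤ K ^ 100 := one_le_pow₀ hK1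
  have h1 : ε ≤ 1 := h100.trans (by rw [div_le_iff₀ (by positivity)]; linarith)
  refine ⟨h1, ?_, h100, ?_⟩
  · have h2 : ε ^ 2 ≤ (1 / K ^ 100) ^ 2 := pow_le_pow_left₀ hε.le h100 2
    refine h2.trans ?_
    rw [div_pow, one_pow, div_le_div_iff₀ (by positivity) (by positivity), one_mul, one_mul]
    calc 12 * K ^ 20 ≤ K ^ 180 * K ^ 20 := by
          have : (12 : ℝ) ≤ K ^ 180 := by
            have : (16 : ℝ) ^ 180 ≤ K ^ 180 := pow_le_pow_left₀ (by norm_num) hK 180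
            linarith
          exact mul_le_mul_of_nonneg_right this (by positivity)
      _ = (K ^ 100) ^ 2 := by ring
  · have hsq : ε ^ 2 ≤ exp (-(1800 * M * Real.log K / K)) / K ^ 4600 := by
      have h := pow_le_pow_left₀ hε.le hεle 2
      refine h.trans (le_of_eq ?_)
      rw [div_pow, ← Real.exp_nat_mul]
      congr 1
      · congr 1; push_cast; ring
      · ring
    have hE : exp (5 * M * (888 * Real.log K / M + K⁻¹ + 300 * Real.log K / K))
        = K ^ 4440 * exp (5 * M / K + 1500 * M * Real.log K / K) := by
      have : 5 * M * (888 * Real.log K / M + K⁻¹ + 300 * Real.log K / K)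
          = (4440 : ℕ) * Real.log K + (5 * M / K + 1500 * M * Real.log K / K) := by
        push_cast; field_simp; ring
      rw [this, exp_add, Real.exp_nat_mul, Real.exp_log hK0]
    rw [hE]
    have hcomb : exp (-(1800 * M * Real.log K / K)) * exp (5 * M / K + 1500 * M * Real.log K / K)
        = exp (M / K * (5 - 300 * Real.log K)) := by
      rw [← exp_add]; congr 1; field_simp; ring
    have hneg : exp (M / K * (5 - 300 * Real.log K)) ≤ 1 := by
      rw [exp_le_one_iff]
      have h4 : 5 - 300 * Real.log K ≤ 0 := by linarith
      have hMK0 : 0 ≤ M / K := by positivity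
      nlinarith
    have h64 : (64 : ℝ) ≤ K ^ 170 := by
      have : (16 : ℝ) ^ 170 ≤ K ^ 170 := pow_le_pow_left₀ (by norm_num) hK 170
      norm_num at this
      linarith
    calc 64 * M * ε ^ 2 * (K ^ 4440 * exp (5 * M / K + 1500 * M * Real.log K / K))
        ≤ 64 * M * (exp (-(1800 * M * Real.log K / K)) / K ^ 4600)
            * (K ^ 4440 * exp (5 * M / K + 1500 * M * Real.log K / K)) := by gcongr
      _ = 64 * M / K ^ 160 * (exp (-(1800 * M * Real.log K / K))
            * exp (5 * M / K + 1500 * M * Real.log K / K)) := by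
          field_simp
      _ = 64 * M / K ^ 160 * exp (M / K * (5 - 300 * Real.log K)) := by rw [hcomb]
      _ ≤ 64 * M / K ^ 160 * 1 := mul_le_mul_of_nonneg_left hneg (by positivity)
      _ ≤ K ^ 20 := by
          rw [mul_one, div_le_iff₀ (by positivity)]
          calc 64 * M ≤ K ^ 170 * K ^ 10 := mul_le_mul h64 hMK hM0.le (by positivity)
            _ = K ^ 20 * K ^ 160 := by ring

end Numerics

end HeadStart

/-! ## The head-start gate theorem under the polynomial threshold -/

open HeadStart in
/-- **THE HEAD-START GATE THEOREM WITH THE EARLY ONSET, under the polynomial amplitude threshold.** As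
`HeadStart.firingPhase` (tree) with `ε ≤ e^{-10M}/K¹⁰⁰` replaced by `ε ≤ e^{-900·M·log K/K}/K²³⁰⁰`, and (beable)
from the delivery time `t_c + 888 log K/M + 1/K + 300 log K/K` on. HONEST FRAMING: a theorem about a
five-mode ODE; low prior, high value-of-information experiment on Tao's machine paradigm; NOT a claim that NS
blows up. [cite: Tao2016AveragedNS, Theorem 5.3, §5.5] -/
theorem HeadStart.firingPhase_poly_early {K M ε η : ℝ} {E X : ℝ → Fin 5 → ℝ}
    (hX : ∀ t ∈ Icc (0:ℝ) 2, HasDerivAt X (delayCircuitWith K M ε (X t) - E t * X t) t)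
    (hE : ∀ t ∈ Icc (0:ℝ) 2, ∀ i, 0 ≤ E t i ∧ E t i ≤ η)
    (h0 : X 0 0 ^ 2 + X 0 1 ^ 2 = 1 ∧ 0 ≤ X 0 0 ∧ -(1 / 5 * ε) ≤ X 0 1 ∧ X 0 1 ≤ 2 / 5 * ε ∧ X 0 2 = 0 ∧ X 0 3 = 0 ∧ X 0 4 = 0)
    (hK : 2 * 20 ^ 42 * (Nat.factorial 42 : ℝ) + 16 ≤ K) (hML : 3000 * Real.log K ≤ M)
    (hMK : M ≤ K ^ 10) (hε : 0 < ε) (hεle : ε ≤ exp (-(900 * M * Real.log K / K)) / K ^ 2300)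
    (hη : η ≤ 1 / 1000) :
    ∃ tc : ℝ, |tc + X 0 1 / ε - Real.sqrt (2 + (X 0 1 / ε) ^ 2)| ≤ 24 * Real.log K / M + 30 * η + (max (-(X 0 1 / ε)) 0) ^ 2 ∧
      (∀ t ∈ Icc 0 tc,
        |X t 0 - 1| ≤ 200 / K ^ 10 + 2 * η ∧ ∀ i : Fin 5, i ≠ 0 → |X t i| ≤ 200 / K ^ 10) ∧
      (∀ t ∈ Icc (tc + 888 * Real.log K / M + 1 / K + 300 * Real.log K / K) 2,
        |X t 4 - 1| ≤ 200 / K ^ 10 + 4 * η ∧ ∀ i : Fin 5, i ≠ 4 → |X t i| ≤ 200 / K ^ 10) := by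
  obtain ⟨hK16, hM0, -, hlog2, -, -⟩ := family_params hK hML
  have hf : (1:ℝ) ≤ (Nat.factorial 42 : ℝ) := Nat.one_le_cast.2 (Nat.factorial_pos 42)
  have hK400 : (400:ℝ) ≤ K := by linarith
  obtain ⟨hδ0, hon, hδle⟩ := family_params_damped hK hML
  have hK0 : 0 < K := by linarith
  have hK1 : 1 ≤ K := by linarith
  have hu0' : 0 < K⁻¹ := inv_pos.2 hK0
  have hη0 : 0 ≤ η := (hE 0 ⟨le_rfl, zero_le_two⟩ 0).1.trans (hE 0 ⟨le_rfl, zero_le_two⟩ 0).2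
  have hη100 : η ≤ 1 / 100 := hη.trans (by norm_num)
  have hML1250 : 1250 * Real.log K ≤ M := by linarith
  have hlog0 : 0 ≤ Real.log K := by linarith
  have hL0 : 0 ≤ 300 * Real.log K / K := by positivity
  have hKM : exp (-M) ≤ 1 / K ^ 10 := exp_neg_le_inv_pow hK0 (by linarith)
  obtain ⟨hε1, hεK, hε100, hεT⟩ := pulse_eps_facts hK16 hM0 hMK hε hεle
  have hh5 : -(1 / 5) ≤ X 0 1 / ε := by rw [le_div_iff₀ hε]; linarith [h0.2.2.1]
  obtain ⟨τ, ⟨hlo, hhi, hτ1, hτ33⟩, hcτeq, hwin⟩ :=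
    quietPhase hX hE h0 hε hε1 hM0 hMK hK16 hML1250 hεK hη
  have hcτ : ∀ t, 0 ≤ t → t ≤ τ → X t 2 ≤ ε ^ 2 / K ^ 10 :=
    fun t h0t htτ => (hwin t ⟨h0t, htτ⟩).1.2
  have hfit2 : τ + 888 * Real.log K / M + K⁻¹ + 300 * Real.log K / K ≤ 2 := by
    have h1 : τ + 888 * Real.log K / M + (sqrt K)⁻¹ ≤ 2 := window_fits hK400 hτ33 hδle
    have h2 : K⁻¹ + 300 * Real.log K / K ≤ (sqrt K)⁻¹ := inv_add_log_le_invSqrt (K0_ge hK)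
    linarith
  have hτ2 : τ ≤ 2 := by linarith
  have hεT' : 64 * M * ε ^ 2 * exp (5 * M * ((τ + 888 * Real.log K / M + K⁻¹ + 300 * Real.log K / K) - τ))
      ≤ K ^ 20 := by
    have : (τ + 888 * Real.log K / M + K⁻¹ + 300 * Real.log K / K) - τ
        = 888 * Real.log K / M + K⁻¹ + 300 * Real.log K / K := by ring
    rw [this]; exact hεT
  refine ⟨τ, ?_, ?_, ?_⟩
  · have hq0 : 0 ≤ (max (-(X 0 1 / ε)) 0) ^ 2 := sq_nonneg _
    have hx : 0 ≤ 24 * Real.log K / M + 30 * η + (max (-(X 0 1 / ε)) 0) ^ 2 := by positivity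
    have hyx : 10 / M + 30 * η ≤ 24 * Real.log K / M + 30 * η + (max (-(X 0 1 / ε)) 0) ^ 2 := by
      have : 10 / M ≤ 24 * Real.log K / M := div_le_div_of_nonneg_right (by linarith) hM0.le
      linarith
    exact abs_add_sub_sqrt_le hτ1 hh5 hx hyx (by linarith) (by linarith)
  · intro t ht
    exact able_window hX hE h0 hε hε1 hM0.le hK16 hεK hε100 hτ2 hcτ ht
  · intro t ht
    have ht' : t ∈ Icc (τ + 888 * Real.log K / M + K⁻¹ + 300 * Real.log K / K) 2 := by
      refine ⟨?_, ht.2⟩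
      have h1 := ht.1
      rw [one_div] at h1
      linarith
    have ht0 : t ∈ Icc (0:ℝ) 2 := ⟨by linarith [ht'.1], ht.2⟩
    exact beable_of_sum_sq hX hE h0 hK16 ht0
      (sum_sq_from (T := τ + 888 * Real.log K / M + K⁻¹ + 300 * Real.log K / K) hX hE h0 hε hε1 hM0
        hMK hK16 hεK hε100 hKM hη100 hδ0 hon hL0 (drain_numeric hK16) hτ1 le_rfl hfit2 hεT' hcτ
        hcτeq ht')

open HeadStart in
/-- **THE HEAD-START GATE THEOREM UNDER THE POLYNOMIAL AMPLITUDE THRESHOLD** — `HeadStart.firingPhase`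
(tree) VERBATIM with the single change `ε ≤ e^{-10M}/K¹⁰⁰ ↦ ε ≤ e^{-900·M·log K/K}/K²³⁰⁰`. For
`K ≥ 2·20⁴²·42! + 16`, `3000 log K ≤ M ≤ K¹⁰`, `0 < ε ≤ e^{-900·M·log K/K}/K²³⁰⁰`, ANY diagonal damping
`0 ≤ Eᵢ(t) ≤ η ≤ 1/1000` on `[0,2]` and ANY `X` with `Ẋ = delayCircuitWith K M ε X - E(t) * X` on `[0,2]` from
ANY datum of `HS±(ε)` (`h = b₀/ε`, `h₋ = max(-h,0)`): a critical time `t_c` with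
`|t_c + h - √(2 + h²)| ≤ 24 log K / M + 30η + h₋²`; (able) on `[0, t_c]`; (beable) on
`[t_c + 888 log K/M + 1/√K, 2]` — `|ã - 1| ≤ 200K⁻¹⁰ + 4η`, `|a|,|b|,|c|,|d| ≤ 200K⁻¹⁰`. HONEST FRAMING: a
theorem about a five-mode ODE; low prior, high value-of-information experiment on Tao's machine paradigm; NOT
a claim that NS blows up. [cite: Tao2016AveragedNS, Theorem 5.3, §5.5] -/
theorem HeadStart.firingPhase_poly {K M ε η : ℝ} {E X : ℝ → Fin 5 → ℝ}
    (hX : ∀ t ∈ Icc (0:ℝ) 2, HasDerivAt X (delayCircuitWith K M ε (X t) - E t * X t) t)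
    (hE : ∀ t ∈ Icc (0:ℝ) 2, ∀ i, 0 ≤ E t i ∧ E t i ≤ η)
    (h0 : X 0 0 ^ 2 + X 0 1 ^ 2 = 1 ∧ 0 ≤ X 0 0 ∧ -(1 / 5 * ε) ≤ X 0 1 ∧ X 0 1 ≤ 2 / 5 * ε ∧ X 0 2 = 0 ∧ X 0 3 = 0 ∧ X 0 4 = 0)
    (hK : 2 * 20 ^ 42 * (Nat.factorial 42 : ℝ) + 16 ≤ K) (hML : 3000 * Real.log K ≤ M)
    (hMK : M ≤ K ^ 10) (hε : 0 < ε) (hεle : ε ≤ exp (-(900 * M * Real.log K / K)) / K ^ 2300)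
    (hη : η ≤ 1 / 1000) :
    ∃ tc : ℝ, |tc + X 0 1 / ε - Real.sqrt (2 + (X 0 1 / ε) ^ 2)| ≤ 24 * Real.log K / M + 30 * η + (max (-(X 0 1 / ε)) 0) ^ 2 ∧
      (∀ t ∈ Icc 0 tc,
        |X t 0 - 1| ≤ 200 / K ^ 10 + 2 * η ∧ ∀ i : Fin 5, i ≠ 0 → |X t i| ≤ 200 / K ^ 10) ∧
      (∀ t ∈ Icc (tc + 888 * Real.log K / M + 1 / Real.sqrt K) 2,
        |X t 4 - 1| ≤ 200 / K ^ 10 + 4 * η ∧ ∀ i : Fin 5, i ≠ 4 → |X t i| ≤ 200 / K ^ 10) := by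
  obtain ⟨tc, hwin, hable, hbe⟩ := HeadStart.firingPhase_poly_early hX hE h0 hK hML hMK hε hεle hη
  have hKL : K⁻¹ + 300 * Real.log K / K ≤ (sqrt K)⁻¹ := inv_add_log_le_invSqrt (K0_ge hK)
  refine ⟨tc, hwin, hable, fun t ht => hbe t ⟨?_, ht.2⟩⟩
  have h1 := ht.1
  rw [one_div] at h1 ⊢
  linarith

open HeadStart in
/-- **Linear-band corollary**: if moreover `900·M·log K ≤ K`, the plainly polynomial `ε ≤ K⁻²³⁰¹` suffices
(`e^{-900·M·log K/K} ≥ e^{-1} ≥ 1/K`). [cite: Tao2016AveragedNS, Theorem 5.3, §5.5] -/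
theorem HeadStart.firingPhase_polyLinear {K M ε η : ℝ} {E X : ℝ → Fin 5 → ℝ}
    (hX : ∀ t ∈ Icc (0:ℝ) 2, HasDerivAt X (delayCircuitWith K M ε (X t) - E t * X t) t)
    (hE : ∀ t ∈ Icc (0:ℝ) 2, ∀ i, 0 ≤ E t i ∧ E t i ≤ η)
    (h0 : X 0 0 ^ 2 + X 0 1 ^ 2 = 1 ∧ 0 ≤ X 0 0 ∧ -(1 / 5 * ε) ≤ X 0 1 ∧ X 0 1 ≤ 2 / 5 * ε ∧ X 0 2 = 0 ∧ X 0 3 = 0 ∧ X 0 4 = 0)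
    (hK : 2 * 20 ^ 42 * (Nat.factorial 42 : ℝ) + 16 ≤ K) (hML : 3000 * Real.log K ≤ M)
    (hMK : M ≤ K ^ 10) (hMlin : 900 * M * Real.log K ≤ K) (hε : 0 < ε) (hεle : ε ≤ 1 / K ^ 2301)
    (hη : η ≤ 1 / 1000) :
    ∃ tc : ℝ, |tc + X 0 1 / ε - Real.sqrt (2 + (X 0 1 / ε) ^ 2)| ≤ 24 * Real.log K / M + 30 * η + (max (-(X 0 1 / ε)) 0) ^ 2 ∧
      (∀ t ∈ Icc 0 tc,
        |X t 0 - 1| ≤ 200 / K ^ 10 + 2 * η ∧ ∀ i : Fin 5, i ≠ 0 → |X t i| ≤ 200 / K ^ 10) ∧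
      (∀ t ∈ Icc (tc + 888 * Real.log K / M + 1 / Real.sqrt K) 2,
        |X t 4 - 1| ≤ 200 / K ^ 10 + 4 * η ∧ ∀ i : Fin 5, i ≠ 4 → |X t i| ≤ 200 / K ^ 10) := by
  obtain ⟨hK16, hM0, -⟩ := family_params hK hML
  have hK0 : 0 < K := by linarith
  have hdiv : 900 * M * Real.log K / K ≤ 1 := by rw [div_le_iff₀ hK0]; linarith
  have he1 : K⁻¹ ≤ exp (-(900 * M * Real.log K / K)) := by
    have h3 : exp (1:ℝ) ≤ K := by
      have := Real.exp_one_lt_d9; linarith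
    calc K⁻¹ ≤ (exp 1)⁻¹ := by
          rw [inv_le_inv₀ hK0 (exp_pos 1)]; exact h3
      _ = exp (-1) := by rw [Real.exp_neg]
      _ ≤ exp (-(900 * M * Real.log K / K)) := by rw [exp_le_exp]; linarith
  have hεle' : ε ≤ exp (-(900 * M * Real.log K / K)) / K ^ 2300 := by
    refine hεle.trans ?_
    rw [show (1 : ℝ) / K ^ 2301 = K⁻¹ / K ^ 2300 by
      rw [pow_succ, one_div, mul_inv, div_eq_mul_inv, mul_comm]]
    exact div_le_div_of_nonneg_right he1 (by positivity)
  exact HeadStart.firingPhase_poly hX hE h0 hK hML hMK hε hεle' hη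

open HeadStart in
/-- The polynomial-threshold head-start gate theorem for the EXPLICIT datum `(√(1 - b₀²), b₀, 0, 0, 0)`,
`-ε/5 ≤ b₀ ≤ 2ε/5` — `HeadStart.firingPhase_explicit` (tree) with `ε ≤ e^{-900·M·log K/K}/K²³⁰⁰`.
[cite: Tao2016AveragedNS, Theorem 5.3, §5.5] -/
theorem HeadStart.firingPhase_poly_explicit {K M ε η b₀ : ℝ} {E X : ℝ → Fin 5 → ℝ}
    (hX : ∀ t ∈ Icc (0:ℝ) 2, HasDerivAt X (delayCircuitWith K M ε (X t) - E t * X t) t)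
    (hE : ∀ t ∈ Icc (0:ℝ) 2, ∀ i, 0 ≤ E t i ∧ E t i ≤ η)
    (hb0 : -(1 / 5 * ε) ≤ b₀) (hb : b₀ ≤ 2 / 5 * ε) (h0 : X 0 = ![sqrt (1 - b₀ ^ 2), b₀, 0, 0, 0])
    (hK : 2 * 20 ^ 42 * (Nat.factorial 42 : ℝ) + 16 ≤ K) (hML : 3000 * Real.log K ≤ M)
    (hMK : M ≤ K ^ 10) (hε : 0 < ε) (hεle : ε ≤ exp (-(900 * M * Real.log K / K)) / K ^ 2300)
    (hη : η ≤ 1 / 1000) :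
    ∃ tc : ℝ, |tc + b₀ / ε - Real.sqrt (2 + (b₀ / ε) ^ 2)| ≤ 24 * Real.log K / M + 30 * η + (max (-(b₀ / ε)) 0) ^ 2 ∧
      (∀ t ∈ Icc 0 tc,
        |X t 0 - 1| ≤ 200 / K ^ 10 + 2 * η ∧ ∀ i : Fin 5, i ≠ 0 → |X t i| ≤ 200 / K ^ 10) ∧
      (∀ t ∈ Icc (tc + 888 * Real.log K / M + 1 / Real.sqrt K) 2,
        |X t 4 - 1| ≤ 200 / K ^ 10 + 4 * η ∧ ∀ i : Fin 5, i ≠ 4 → |X t i| ≤ 200 / K ^ 10) := by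
  obtain ⟨hK16, hM0, -⟩ := family_params hK hML
  have hε1 : ε ≤ 1 := (pulse_eps_facts hK16 hM0 hMK hε hεle).1
  have hb1 : X 0 1 = b₀ := by rw [h0]; rfl
  have h := HeadStart.firingPhase_poly hX hE (hs_of_explicit hε1 hb0 hb h0) hK hML hMK hε hεle hη
  rwa [hb1] at h

end Summit.NavierStokesRegularity.FluidComputer
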